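import Summits.CriticalPhenomena.PercolationContinuityZ3.Theorems.Transplant.SiteCSHTheoremOne
import HarnessLib

/-!
# SITE percolation: Kozma–Nitzan's Conjecture 1 in its printed MULTIPLICATIVE form,
# `P(o ↔ b) ≥ P(o ↔ A) · min_{a ∈ A} P(a ↔ b)`, on every finite graph with vertex weights — unconditionally
# (lane `prim-bschramm`, class C1a; prover `prim-hp-8` gen 17, author lineage of the bond chain p205010)

builds on p205010 (kernel theorem, internal audit signed; external expert review pending).

`SiteTransplant.SiteMultiplicativeGluing` (p207293) — `P(o ↔ A)·t ≤ P(o ↔ b)` for every common lower bound `t`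
of the `P(a ↔ b)`, `a ∈ A` — was the last undischarged statement of `SiteTransplantGluingReductions.lean`:
the site chain (p215077) proves the ADDITIVE form `SiteAdditiveGluing` and (AG-loc)_site, and the tree had only
the downward reduction `siteAdditiveGluing_of_siteMultiplicativeGluing`.  This file proves the multiplicative
form from (AG-loc)_site by the first-in-rank partition of `{o ↔ A}`:
`P(o ↔ A) − P(o ↔ b) ≤ P(o ↔ A, o ↮ b) ≤ Σ_a P(P^o_a)·(1 − P(a ↔ b)) ≤ (1 − t)·Σ_a P(P^o_a) = (1 − t)·P(o ↔ A)`.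

* `SiteTransplant.siteMultiplicativeGluing_of_siteAGloc : SiteAGloc → SiteMultiplicativeGluing`;
* **`SiteCSH.siteMultiplicativeGluing_holds : SiteMultiplicativeGluing`** (OURS — site Conjecture 1 of
  Kozma–Nitzan verbatim, every finite graph, every vertex-weight vector in `[0,1]^V`, every relay set);
* `SiteCSH.siteKN_conjecture1_min` — the same with `t = min_{a ∈ A} P(a ↔ b)` (`Finset.inf'`) for `A ≠ ∅`.

Support file (`--supports stmt-CriticalPhenomena-4575 --as helper`); no definitions, no named facts, no sorries.
[cite: KozmaNitzan2024, Conj. 1 (p. 3)] [cite: GrimmettPercolation1999, §1.6 p. 24]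
-/

namespace Summit.CriticalPhenomena.PercolationContinuityZ3.Theorems

open MeasureTheory Set Finset
open Literature.Probability.LatticeModels (prodBernoulli)
open Literature.Probability.Percolation

namespace SiteTransplant

/-- **`SiteAGloc ⇒ SiteMultiplicativeGluing`.**  From the localised union bound (first-in-rank form) and the
partition `Σ_a P(P^o_a) = P(o ↔ A)` (`site_sum_measureReal_firstRank`):
`P(o ↔ A) − P(o ↔ b) ≤ P(o ↔ A, o ↮ b) ≤ Σ_a P(P^o_a)(1 − P(a ↔ b)) ≤ (1 − t)·P(o ↔ A)` whenever
`t ≤ P(a ↔ b)` for all `a ∈ A`; i.e. `P(o ↔ A)·t ≤ P(o ↔ b)`. [cite: KozmaNitzan2024, Conj. 1 (p. 3)] -/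
theorem siteMultiplicativeGluing_of_siteAGloc (h : SiteAGloc) : SiteMultiplicativeGluing := by
  intro n G q A o b t hrel
  classical
  set μ := prodBernoulli q with hμ
  have hmeas : ∀ S : Set (SiteConfig (Fin n)), MeasurableSet S := fun S =>
    (Set.toFinite S).measurableSet
  obtain ⟨r, hrinj, hrc⟩ := AGloc.exists_rank_compat A (fun a => μ.real (siteConn G a b))
  have key := h n G q A o b r hrinj hrc
  rw [← hμ] at key
  -- termwise: `P(P_a)·(1 − P(a ↔ b)) ≤ P(P_a)·(1 − t)`
  have h1 : ∑ a ∈ A, μ.real (siteConn G o a ∩ ⋂ a' ∈ A.filter (fun a' => r a' < r a),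
        (siteConn G o a')ᶜ : Set (SiteConfig (Fin n))) * (1 - μ.real (siteConn G a b)) ≤
      ∑ a ∈ A, μ.real (siteConn G o a ∩ ⋂ a' ∈ A.filter (fun a' => r a' < r a),
        (siteConn G o a')ᶜ : Set (SiteConfig (Fin n))) * (1 - t) := by
    refine Finset.sum_le_sum fun a ha => ?_
    exact mul_le_mul_of_nonneg_left (by linarith [hrel a ha]) measureReal_nonneg
  -- the first-in-rank patterns partition `{o ↔ A}`
  have h2 : ∑ a ∈ A, μ.real (siteConn G o a ∩ ⋂ a' ∈ A.filter (fun a' => r a' < r a),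
        (siteConn G o a')ᶜ : Set (SiteConfig (Fin n))) * (1 - t) =
      (1 - t) * μ.real (⋃ a ∈ A, siteConn G o a) := by
    rw [← Finset.sum_mul, mul_comm, site_sum_measureReal_firstRank G q A r o hrinj]
  -- `P(o ↔ A) − P(o ↔ b) ≤ P(o ↔ A, o ↮ b)`
  have h4 : μ.real (⋃ a ∈ A, siteConn G o a) - μ.real (siteConn G o b) ≤
      μ.real ((⋃ a ∈ A, siteConn G o a) ∩ (siteConn G o b)ᶜ : Set (SiteConfig (Fin n))) := by
    have hsp : μ.real (⋃ a ∈ A, siteConn G o a) =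
        μ.real ((⋃ a ∈ A, siteConn G o a) ∩ siteConn G o b : Set (SiteConfig (Fin n))) +
          μ.real ((⋃ a ∈ A, siteConn G o a) ∩ (siteConn G o b)ᶜ : Set (SiteConfig (Fin n))) := by
      rw [← measureReal_inter_add_sdiff (s := ⋃ a ∈ A, (siteConn G o a : Set (SiteConfig (Fin n))))
        (h := measure_ne_top _ _) (hmeas (siteConn G o b)), Set.sdiff_eq]
    have hm : μ.real ((⋃ a ∈ A, siteConn G o a) ∩ siteConn G o b : Set (SiteConfig (Fin n))) ≤
        μ.real (siteConn G o b) :=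
      measureReal_mono Set.inter_subset_right (measure_ne_top _ _)
    linarith
  nlinarith [key, h1, h2, h4]

end SiteTransplant

namespace Transplant

namespace SiteCSH

open Summit.CriticalPhenomena.PercolationContinuityZ3.Theorems.SiteTransplant
  (SiteMultiplicativeGluing siteMultiplicativeGluing_of_siteAGloc siteConn)

/-- **SITE KOZMA–NITZAN CONJECTURE 1 (multiplicative form), unconditionally** (OURS): on every finite graph
`G` with vertex weights `q ∈ [0,1]^V`, for all `o, b`, every relay set `A` and every `t` with `t ≤ P(a ↔ b)`
for all `a ∈ A`, `P(o ↔ A)·t ≤ P(o ↔ b)` for site connections (convention A: both endpoints open).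
From (AG-loc)_site (`siteAGloc_holds`, p215077 ← the site conditioned slack hierarchy `siteCSHAll_holds`).
[cite: KozmaNitzan2024, Conj. 1 (p. 3)] -/
theorem siteMultiplicativeGluing_holds : SiteMultiplicativeGluing :=
  siteMultiplicativeGluing_of_siteAGloc siteAGloc_holds

/-- **Site Conjecture 1 with the minimum written out**: for `A ≠ ∅`,
`P(o ↔ A) · min_{a ∈ A} P(a ↔ b) ≤ P(o ↔ b)`. [cite: KozmaNitzan2024, Conj. 1 (p. 3)] -/
theorem siteKN_conjecture1_min (n : ℕ) (G : SimpleGraph (Fin n)) (q : Fin n → unitInterval)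
    (A : Finset (Fin n)) (hA : A.Nonempty) (o b : Fin n) :
    (prodBernoulli q).real (⋃ a ∈ A, siteConn G o a) *
        A.inf' hA (fun a => (prodBernoulli q).real (siteConn G a b)) ≤
      (prodBernoulli q).real (siteConn G o b) :=
  siteMultiplicativeGluing_holds n G q A o b _ fun _ ha => Finset.inf'_le _ ha

end SiteCSH

end Transplant

end Summit.CriticalPhenomena.PercolationContinuityZ3.Theorems
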